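import Mathlib.LinearAlgebra.Matrix.Determinant.Basic
import Mathlib.LinearAlgebra.Matrix.Notation
import Literature.NumberTheory.EllipticCurves.Fisher2012.HesseFamilyFiveCongruence
import HarnessLib

/-!
# Fisher 2014: the families of elliptic curves `7`-congruent to a given one (the twists `X_E(7)`, `X_E⁻(7)` of the
# Klein quartic and the Weierstrass equations of the curves they parametrise)

NAMED FACTS (two, published, with proofs in print) + definitions + proved transport lemmas, in topic
`NumberTheory/EllipticCurves`, namespace `Literature.NumberTheory.EllipticCurves.Fisher2014`.  The `n = 7` companion of
`Fisher2012/HesseFamilyFiveCongruence.lean` (`X_E(5) ≅ ℙ¹`, the Hesse pencil).  Written for the cell `b2b-bsdres`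
(run/shared/lean/b2b/bsd-rank1-residual/), whose HONEST FRAMING applies to its use there: the goal of that cell is to DELETE
the COMBINATION-SHAPED residual classes for ALL analytic-rank `≤ 1` elliptic curves over `ℚ` — "full BSD formula for every
rank `≤ 1` curve in class C" assembled STRICTLY from published theorems — so that the rank-`≤ 1` remainder becomes exactly the
CONSTRUCTION-SHAPED classes, which are TYPED (missing-input `Prop`s), NOT attempted; this is not "finishing BSD".  Use in the
cell: the visibility certificates at `p = 7` (`Rank1Residual/Supersingular/X7VisibilityRecordsC3/C4`, …) display the
`7`-congruence `θ : F[7] ≃ E[7]` of the rank-2 partner `F` as a HYPOTHESIS; for `n = 7` the modular curve `X_E(7)` has genus `3`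
(a twist of the Klein quartic), so a partner is a RATIONAL POINT of a plane quartic, and the facts below turn such a point into
the isomorphism of Galois modules — replacing the trace/Sturm (Kraus–Oesterlé) certificate, which is impractical at the
conductors (`10⁵`–`4·10⁵`) these partners have, by a theorem plus one exact evaluation.

## The source (T. Fisher, *On families of 7- and 11-congruent elliptic curves*, LMS J. Comput. Math. 17 (2014) 536–564,
## doi:10.1112/S1461157014000059; held copy `paper:doi-10-1112-s1461157014000059`), verbatim

§1 p. 536: "Elliptic curves `E₁` and `E₂` over a field `K` are `n`-congruent if their `n`-torsion subgroups `E₁[n]` and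
`E₂[n]` are isomorphic as Galois modules. They are directly `n`-congruent if the isomorphism `φ : E₁[n] ≅ E₂[n]` respects the
Weil pairing `eₙ`, and reverse `n`-congruent if `eₙ(φP, φQ) = eₙ(P,Q)⁻¹` for all `P, Q ∈ E₁[n]`. The elliptic curves directly
`n`-congruent to a given elliptic curve `E` are parameterised by the modular curve `Y_E(n) = X_E(n) ∖ {cusps}`."  §1.1
p. 538: "We write `X_E⁻(n)` for `X_E^{(−1)}(n)`" and "The elliptic curves reverse `n`-congruent to `E` are parameterised by
the modular curve `Y_E⁻(n) = X_E⁻(n) ∖ {cusps}`" (p. 537).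
§3.2 p. 544 (the Klein quartic `F = a³b + b³c + c³a`, variables `a, b, c`): "Following Klein … we put
`H = (−1/54) × |∂²F/∂a², ∂²F/∂a∂b, ∂²F/∂a∂c; ∂²F/∂a∂b, ∂²F/∂b², ∂²F/∂b∂c; ∂²F/∂a∂c, ∂²F/∂b∂c, ∂²F/∂c²|`,
`c₄ = (1/9) × |∂²F/∂a², ∂²F/∂a∂b, ∂²F/∂a∂c, ∂H/∂a; ∂²F/∂a∂b, ∂²F/∂b², ∂²F/∂b∂c, ∂H/∂b; ∂²F/∂a∂c, ∂²F/∂b∂c, ∂²F/∂c²,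
∂H/∂c; ∂H/∂a, ∂H/∂b, ∂H/∂c, 0|`, `c₆ = (1/14) × |∂F/∂a, ∂F/∂b, ∂F/∂c; ∂H/∂a, ∂H/∂b, ∂H/∂c; ∂c₄/∂a, ∂c₄/∂b, ∂c₄/∂c|`."
§4.1 p. 552: "Let `X = {𝓕 = 0} ⊂ ℙ²` be a twist of `X(7)`. Starting with `𝓕` in place of the Klein quartic `F`, the formulae
in § 3.2 define polynomials `H(𝓕)`, `c₄(𝓕)` and `c₆(𝓕)`."
**Theorem 3.9** (p. 546). "Let `E/K` be an elliptic curve with Weierstrass equation `y² = x³ − 27c₄x − 54c₆` and let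
`Δ = (c₄³ − c₆²)/1728`. If `j(E) ≠ 0, 1728` then `X_E(7) ⊂ ℙ²` has equation `𝓕 = 0` where
`𝓕 = 12x³z + 108x²y² + 3c₄x²z² + 72c₄xy²z − 108c₄y⁴ − 12c₆xyz² + 84c₆y³z + c₄²xz³ − 15c₄²y²z² + c₄c₆yz³ + 768Δz⁴`,
and `X_E⁻(7) ⊂ ℙ²` has equation `𝓖 = 0` where
`𝓖 = 3x⁴ + c₄x³z − 18c₄x²y² − 3c₆x²yz + 24c₆xy³ + 3c₄²xy²z − 9c₄²y⁴ − c₄c₆y³z + 168Δxz³ + 1728Δy²z² + 5c₄Δz⁴`."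
**Theorem 4.6** (p. 555). "Let `X = {𝓕 = 0} ⊂ ℙ²` be a twist of the Klein quartic, with hyperplane section `H`. Let
`T = P₁ + P₂ + P₃` where `P₁, P₂, P₃` are points of inflection on `X` with `P₁ + 3P₂ ∼ P₂ + 3P₃ ∼ P₃ + 3P₁ ∼ H`. Let
`d ∈ K[x,y,z]` be a cubic form with `{d = 0}` meeting `X` in a divisor `2D` with `D ∼ 2T`. Then there is a
`Gal(K̄/K)`-module `M` such that for every field extension `L/K` and rational point `P = (x : y : z) ∈ X(L) ∖ {d = 0}`, not a
point of inflection, the elliptic curve `Y² = X³ − 27 (c₄(𝓕)(x,y,z)/d(x,y,z)²) X − 54 (c₆(𝓕)(x,y,z)/d(x,y,z)³)` (4.8) has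
`7`-torsion isomorphic to `M` as a `Gal(L̄/L)`-module."
**Theorem 4.8** (p. 555). "Let `E/K` be an elliptic curve with Weierstrass equation `y² = x³ − 27c₄x − 54c₆` and let
`Δ = (c₄³ − c₆²)/1728`. If `j(E) ≠ 0, 1728` then the families of elliptic curves parameterised by `Y_E(7)` and `Y_E⁻(7)`
are given by (4.8) with `(𝓕, d) = (𝓕, d₁)` and `(𝓖, d₂)` where `𝓕` and `𝓖` are the quartics in Theorem 3.9 and
`d₁(x,y,z) = −6(3x² + c₄xz − 3c₄y² + c₆yz)z`, `d₂(x,y,z) = 2Δ(4x³ + c₄x²z − 12c₄xy² − 2c₆xyz + 8c₆y³ + c₄²y²z + 200Δz³)`."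
(`K` a field of characteristic `0`, §1.1.  The equation of `X_E(7)` is originally due to Halberstadt–Kraus [HalberstadtKraus2003XE7]
and that of `X_E⁻(7)` to Poonen–Schaefer–Stoll [PoonenSchaeferStoll2007, §7.2], in other coordinates: Theorem 1.1 and
Remark 3.10 of the source.)

## Transcription

* `ℙ²` coordinates are `X 0 = x`, `X 1 = y`, `X 2 = z` of `MvPolynomial (Fin 3) ℚ`; the quartics `𝓕`, `𝓖` of Theorem 3.9 are
  `twistQuartic7 c₄ c₆`, `twistQuartic7Rev c₄ c₆`, the cubics `d₁`, `d₂` of Theorem 4.8 are `twistCubic7`, `twistCubic7Rev`,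
  all written VERBATIM with `Δ = (c₄³ − c₆²)/1728` substituted.  The covariants `H(𝓠)`, `c₄(𝓠)`, `c₆(𝓠)` of a ternary form
  `𝓠` (§3.2 applied to `𝓠`, §4.1) are DEFINED by the printed determinants with Mathlib's `MvPolynomial.pderiv` and `Matrix.det`
  (`kleinH`, `kleinC4`, `kleinC6`) — nothing is expanded by hand; their kernel evaluation at rational points is the business of
  the cell's Summits-side certificate files.  The member (4.8) of the family at `P = (x, y, z) ∈ ℚ³` is the Weierstrass curve
  `twistMember7 c₄ c₆ x y z = ⟨0,0,0, −27·c₄(𝓕)(P)/d₁(P)², −54·c₆(𝓕)(P)/d₁(P)³⟩` (resp. `twistMember7Rev` with `𝓖`, `d₂`);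
  Fisher's `E` is `Fisher2012.c4c6Model c₄ c₆ = ⟨0,0,0,−27c₄,−54c₆⟩`.
* HYPOTHESES, as printed: `j(E) ≠ 0, 1728` — for the elliptic curve `y² = x³ − 27c₄x − 54c₆` (`c₄³ ≠ c₆²`),
  `j = 1728c₄³/(c₄³ − c₆²)`, so this is `c₄ ≠ 0 ∧ c₆ ≠ 0`, which is how it is spelled; `P ∈ X(ℚ)`: `𝓕(P) = 0`;
  `P ∉ {d = 0}`: `d₁(P) ≠ 0`; "not a point of inflection": spelled `H(𝓕)(P) ≠ 0` — the points of inflection of a smooth plane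
  curve over a field of characteristic `0` are its intersections with its Hessian `{H = 0}` (classical; e.g. Brieskorn–Knörrer,
  *Plane Algebraic Curves*, §7.3), and `X_E(7)`, a twist of the (smooth) Klein quartic, is smooth — so this hypothesis IMPLIES
  the printed one (the statement here is weaker than print, never stronger).  The member is moreover ASSUMED non-singular
  (`[(twistMember7 …).IsElliptic]`; print derives it) and `K = ℚ`, `L = ℚ` only.
* CONCLUSION: print gives a SYMPLECTIC (resp. anti-symplectic) isomorphism `E_P[7] ≅ E[7]`; as everywhere in the tree
  (`Fisher2012.thm132_fiveCongruent_hessePencil`, `KrausOesterle1992.prop4_torsionIso_of_congruences`) only the isomorphism of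
  `Γ_ℚ`-modules is stated: a `Γ_ℚ`-equivariant additive equivalence `geomTorsion (twistMember7 …) 7 ≃+ geomTorsion E 7`.
  The Weil-pairing clauses are DROPPED — weaker than print, which is all the visibility consumers use.
  `-- TODO(general form): any field K of characteristic 0 and any extension L/K; the Weil pairing; the cubic forms d_ij of §4.4`
  `-- (formulae covering the points with d₁(P) = 0); the case n = 11 (Theorems 1.2, 3.13, 4.10).`
* PROVED here (no fact): transport to an arbitrary model `W/ℚ` along `W ≅ c4c6Model W.c₄ W.c₆`
  (`Fisher2012.exists_geomTorsion_addEquiv_c4c6Model`): `sevenCongruent_twistMember7[Rev]`.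
* Sanity of the transcription (outside the kernel; cell records `HOME/b2b-bsdres-x10b/gen25/`): the §3.2 recipe reproduces the
  Klein syzygy `c₄³ − c₆² = 1728H⁷` on `X(7)` (105/105 points over `𝔽_ℓ`); for the cell's four `p = 7` visibility pairs
  (`100920b1 ← 100920c1`, `366960u1 ← 366960t1`, `411840jx1 ← 411840ke1`, `422370du1 ← 422370dy1`, Cremona labels, the
  partner of rank `2` found by trace comparison at all good `ℓ ≤ 3000`, kit j156242) the UNIQUE rational point `P` of
  `X_E(7)` with `j(E_P) = j(F)` was computed exactly (resultant + rational roots, PARI/GP kit j229162, and an independent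
  exact Python implementation): in each case `E_P ≅ F` over `ℚ` (explicit scaling `u`), `d₁(P) ≠ 0`, `H(𝓕)(P) ≠ 0`, and
  `X_E⁻(7)` has no rational point above `j(F)` — e.g. `100920b1`: `P = (−364565503772 : 412931 : 3)`, the image under
  Remark 3.10 of the point `(−2477586 : 7142978713896 : 1)` on the Halberstadt–Kraus quartic found by box search (kit j158335).

## References
* T. Fisher, LMS J. Comput. Math. 17 (2014) 536–564, §3.2, Thm. 3.9, §4.1, Thm. 4.6, Thm. 4.8. [Fisher2014SevenElevenCongruent]
* E. Halberstadt, A. Kraus, *Sur la courbe modulaire X_E(7)*, Experiment. Math. 12 (2003) 27–40. [HalberstadtKraus2003XE7]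
* B. Poonen, E. F. Schaefer, M. Stoll, *Twists of X(7) and primitive solutions to x²+y³=z⁷*, Duke Math. J. 137 (2007), §7.
  [PoonenSchaeferStoll2007]
* T. Fisher, Proc. LMS (3) 104 (2012) 613–648 (the `n ≤ 5` analogue; `c4c6Model`). [Fisher2012Hessian]
-/

set_option autoImplicit false

noncomputable section

open scoped Classical

open MvPolynomial WeierstrassCurve
open Literature.NumberTheory.EllipticCurves.Fisher2012 (c4c6Model exists_geomTorsion_addEquiv_c4c6Model)

namespace Literature.NumberTheory.EllipticCurves.Fisher2014

/-! ### Klein's covariants of a ternary form (§3.2, applied to a twisted form as in §4.1) -/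

/-- `H(𝓠) = (−1/54)·|∂²𝓠/∂xᵢ∂xⱼ|` — the Hessian covariant of a ternary form `𝓠` (§3.2 with `𝓠` in place of the Klein
quartic, §4.1; degree `6` for a quartic).  The `3 × 3` determinant of second partial derivatives, by `Matrix.det`.
[cite: Fisher2014SevenElevenCongruent, §3.2 (display defining H) and §4.1] -/
def kleinH (Q : MvPolynomial (Fin 3) ℚ) : MvPolynomial (Fin 3) ℚ :=
  C (-1 / 54 : ℚ) * Matrix.det (Matrix.of fun i j : Fin 3 => pderiv i (pderiv j Q))

/-- `c₄(𝓠) = (1/9)·|∂²𝓠/∂xᵢ∂xⱼ, ∂H/∂xᵢ; ∂H/∂xⱼ, 0|` — the degree-`14` covariant (§3.2 with `𝓠` in place of the Klein quartic,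
§4.1): the `4 × 4` determinant of the Hessian matrix of `𝓠` bordered by the gradient of `H(𝓠)`.
[cite: Fisher2014SevenElevenCongruent, §3.2 (display defining c₄) and §4.1] -/
def kleinC4 (Q : MvPolynomial (Fin 3) ℚ) : MvPolynomial (Fin 3) ℚ :=
  C (1 / 9 : ℚ) * Matrix.det
    !![pderiv 0 (pderiv 0 Q), pderiv 0 (pderiv 1 Q), pderiv 0 (pderiv 2 Q), pderiv 0 (kleinH Q);
       pderiv 1 (pderiv 0 Q), pderiv 1 (pderiv 1 Q), pderiv 1 (pderiv 2 Q), pderiv 1 (kleinH Q);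
       pderiv 2 (pderiv 0 Q), pderiv 2 (pderiv 1 Q), pderiv 2 (pderiv 2 Q), pderiv 2 (kleinH Q);
       pderiv 0 (kleinH Q), pderiv 1 (kleinH Q), pderiv 2 (kleinH Q), 0]

/-- `c₆(𝓠) = (1/14)·|∂𝓠/∂xᵢ; ∂H/∂xᵢ; ∂c₄/∂xᵢ|` — the degree-`21` covariant (§3.2 with `𝓠` in place of the Klein quartic,
§4.1): the Jacobian determinant of `𝓠`, `H(𝓠)`, `c₄(𝓠)`. [cite: Fisher2014SevenElevenCongruent, §3.2 (display defining c₆) and §4.1] -/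
def kleinC6 (Q : MvPolynomial (Fin 3) ℚ) : MvPolynomial (Fin 3) ℚ :=
  C (1 / 14 : ℚ) * Matrix.det
    !![pderiv 0 Q, pderiv 1 Q, pderiv 2 Q;
       pderiv 0 (kleinH Q), pderiv 1 (kleinH Q), pderiv 2 (kleinH Q);
       pderiv 0 (kleinC4 Q), pderiv 1 (kleinC4 Q), pderiv 2 (kleinC4 Q)]

/-! ### The twisted Klein quartics `X_E(7)`, `X_E⁻(7)` (Theorem 3.9) and the cubic forms `d₁`, `d₂` (Theorem 4.8) -/

/-- Theorem 3.9's quartic `𝓕` (an equation of `X_E(7) ⊂ ℙ²` for `E : y² = x³ − 27c₄x − 54c₆`, `j(E) ≠ 0, 1728`):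
`12x³z + 108x²y² + 3c₄x²z² + 72c₄xy²z − 108c₄y⁴ − 12c₆xyz² + 84c₆y³z + c₄²xz³ − 15c₄²y²z² + c₄c₆yz³ + 768Δz⁴`,
`Δ = (c₄³ − c₆²)/1728`; `X 0 = x`, `X 1 = y`, `X 2 = z`. [cite: Fisher2014SevenElevenCongruent, Thm. 3.9 (the quartic F)] -/
def twistQuartic7 (c₄ c₆ : ℚ) : MvPolynomial (Fin 3) ℚ :=
  C 12 * X 0 ^ 3 * X 2 + C 108 * X 0 ^ 2 * X 1 ^ 2 + C (3 * c₄) * X 0 ^ 2 * X 2 ^ 2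
    + C (72 * c₄) * X 0 * X 1 ^ 2 * X 2 - C (108 * c₄) * X 1 ^ 4 - C (12 * c₆) * X 0 * X 1 * X 2 ^ 2
    + C (84 * c₆) * X 1 ^ 3 * X 2 + C (c₄ ^ 2) * X 0 * X 2 ^ 3 - C (15 * c₄ ^ 2) * X 1 ^ 2 * X 2 ^ 2
    + C (c₄ * c₆) * X 1 * X 2 ^ 3 + C (768 * ((c₄ ^ 3 - c₆ ^ 2) / 1728)) * X 2 ^ 4

/-- Theorem 3.9's quartic `𝓖` (an equation of `X_E⁻(7) ⊂ ℙ²` for `E : y² = x³ − 27c₄x − 54c₆`, `j(E) ≠ 0, 1728`):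
`3x⁴ + c₄x³z − 18c₄x²y² − 3c₆x²yz + 24c₆xy³ + 3c₄²xy²z − 9c₄²y⁴ − c₄c₆y³z + 168Δxz³ + 1728Δy²z² + 5c₄Δz⁴`,
`Δ = (c₄³ − c₆²)/1728`. [cite: Fisher2014SevenElevenCongruent, Thm. 3.9 (the quartic G)] -/
def twistQuartic7Rev (c₄ c₆ : ℚ) : MvPolynomial (Fin 3) ℚ :=
  C 3 * X 0 ^ 4 + C c₄ * X 0 ^ 3 * X 2 - C (18 * c₄) * X 0 ^ 2 * X 1 ^ 2 - C (3 * c₆) * X 0 ^ 2 * X 1 * X 2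
    + C (24 * c₆) * X 0 * X 1 ^ 3 + C (3 * c₄ ^ 2) * X 0 * X 1 ^ 2 * X 2 - C (9 * c₄ ^ 2) * X 1 ^ 4
    - C (c₄ * c₆) * X 1 ^ 3 * X 2 + C (168 * ((c₄ ^ 3 - c₆ ^ 2) / 1728)) * X 0 * X 2 ^ 3
    + C (1728 * ((c₄ ^ 3 - c₆ ^ 2) / 1728)) * X 1 ^ 2 * X 2 ^ 2
    + C (5 * c₄ * ((c₄ ^ 3 - c₆ ^ 2) / 1728)) * X 2 ^ 4

/-- Theorem 4.8's cubic form `d₁(x,y,z) = −6(3x² + c₄xz − 3c₄y² + c₆yz)z` (goes with `𝓕`).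
[cite: Fisher2014SevenElevenCongruent, Thm. 4.8 (the cubic form d₁)] -/
def twistCubic7 (c₄ c₆ : ℚ) : MvPolynomial (Fin 3) ℚ :=
  C (-6) * (C 3 * X 0 ^ 2 + C c₄ * X 0 * X 2 - C (3 * c₄) * X 1 ^ 2 + C c₆ * X 1 * X 2) * X 2

/-- Theorem 4.8's cubic form `d₂(x,y,z) = 2Δ(4x³ + c₄x²z − 12c₄xy² − 2c₆xyz + 8c₆y³ + c₄²y²z + 200Δz³)` (goes with `𝓖`),
`Δ = (c₄³ − c₆²)/1728`. [cite: Fisher2014SevenElevenCongruent, Thm. 4.8 (the cubic form d₂)] -/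
def twistCubic7Rev (c₄ c₆ : ℚ) : MvPolynomial (Fin 3) ℚ :=
  C (2 * ((c₄ ^ 3 - c₆ ^ 2) / 1728)) * (C 4 * X 0 ^ 3 + C c₄ * X 0 ^ 2 * X 2 - C (12 * c₄) * X 0 * X 1 ^ 2
    - C (2 * c₆) * X 0 * X 1 * X 2 + C (8 * c₆) * X 1 ^ 3 + C (c₄ ^ 2) * X 1 ^ 2 * X 2
    + C (200 * ((c₄ ^ 3 - c₆ ^ 2) / 1728)) * X 2 ^ 3)

/-! ### The families (4.8) -/

/-- The member of the family (4.8) of Theorem 4.6 at `P = (x, y, z)`, for `(𝓕, d) = (𝓕, d₁)` of Theorem 4.8 (curves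
parametrised by `Y_E(7)`): `Y² = X³ − 27 (c₄(𝓕)(P)/d₁(P)²) X − 54 (c₆(𝓕)(P)/d₁(P)³)`.
[cite: Fisher2014SevenElevenCongruent, Thm. 4.6 display (4.8) with Thm. 4.8 (F, d₁)] -/
def twistMember7 (c₄ c₆ x y z : ℚ) : WeierstrassCurve ℚ :=
  ⟨0, 0, 0,
    -27 * (MvPolynomial.eval ![x, y, z] (kleinC4 (twistQuartic7 c₄ c₆)) /
      MvPolynomial.eval ![x, y, z] (twistCubic7 c₄ c₆) ^ 2),
    -54 * (MvPolynomial.eval ![x, y, z] (kleinC6 (twistQuartic7 c₄ c₆)) /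
      MvPolynomial.eval ![x, y, z] (twistCubic7 c₄ c₆) ^ 3)⟩

/-- The member of the family (4.8) of Theorem 4.6 at `P = (x, y, z)`, for `(𝓕, d) = (𝓖, d₂)` of Theorem 4.8 (curves
parametrised by `Y_E⁻(7)`): `Y² = X³ − 27 (c₄(𝓖)(P)/d₂(P)²) X − 54 (c₆(𝓖)(P)/d₂(P)³)`.
[cite: Fisher2014SevenElevenCongruent, Thm. 4.6 display (4.8) with Thm. 4.8 (G, d₂)] -/
def twistMember7Rev (c₄ c₆ x y z : ℚ) : WeierstrassCurve ℚ :=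
  ⟨0, 0, 0,
    -27 * (MvPolynomial.eval ![x, y, z] (kleinC4 (twistQuartic7Rev c₄ c₆)) /
      MvPolynomial.eval ![x, y, z] (twistCubic7Rev c₄ c₆) ^ 2),
    -54 * (MvPolynomial.eval ![x, y, z] (kleinC6 (twistQuartic7Rev c₄ c₆)) /
      MvPolynomial.eval ![x, y, z] (twistCubic7Rev c₄ c₆) ^ 3)⟩

/-! ### The named facts -/

/-- **Fisher 2014, Theorems 4.6 + 4.8, the family `Y_E(7)`, `K = L = ℚ`** (the equation of `X_E(7)` being Theorem 3.9 /
Halberstadt–Kraus): let `E : y² = x³ − 27c₄x − 54c₆` be an elliptic curve over `ℚ` with `j(E) ≠ 0, 1728` (i.e. `c₄ ≠ 0`,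
`c₆ ≠ 0`), and let `P = (x : y : z)` be a rational point of `X_E(7) = {𝓕 = 0}` with `d₁(P) ≠ 0` which is not a point of
inflection (`H(𝓕)(P) ≠ 0`).  Then the member `E_P` of the family (4.8) (assumed non-singular) is `7`-congruent to `E`: there is
an isomorphism of `Γ_ℚ`-modules `E_P[7] ≅ E[7]` (print: `E_P` is the curve with a SYMPLECTIC isomorphism `E_P[7] ≅ E[7]`
corresponding to `P ∈ Y_E(7)`; the Weil-pairing clause is dropped).  NAMED FACT, not proved here.
[cite: Fisher2014SevenElevenCongruent, Thm. 4.8 with Thm. 4.6, display (4.8), and Thm. 3.9 (pp. 546, 555)] -/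
def thm48_sevenCongruent_twistQuartic7 : Prop :=
  ∀ (c₄ c₆ x y z : ℚ) [(c4c6Model c₄ c₆).IsElliptic] [(twistMember7 c₄ c₆ x y z).IsElliptic],
    c₄ ≠ 0 → c₆ ≠ 0 →
    MvPolynomial.eval ![x, y, z] (twistQuartic7 c₄ c₆) = 0 →
    MvPolynomial.eval ![x, y, z] (twistCubic7 c₄ c₆) ≠ 0 →
    MvPolynomial.eval ![x, y, z] (kleinH (twistQuartic7 c₄ c₆)) ≠ 0 →
    ∃ e : geomTorsion (twistMember7 c₄ c₆ x y z) (7 : ℤ) ≃+ geomTorsion (c4c6Model c₄ c₆) (7 : ℤ),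
      ∀ (σ : Field.absoluteGaloisGroup ℚ) (T : geomTorsion (twistMember7 c₄ c₆ x y z) (7 : ℤ)),
        e (σ • T) = σ • e T

/-- **Fisher 2014, Theorems 4.6 + 4.8, the family `Y_E⁻(7)`, `K = L = ℚ`** (the equation of `X_E⁻(7)` being Theorem 3.9 /
Poonen–Schaefer–Stoll): let `E : y² = x³ − 27c₄x − 54c₆` be an elliptic curve over `ℚ` with `j(E) ≠ 0, 1728` (i.e. `c₄ ≠ 0`,
`c₆ ≠ 0`), and let `P = (x : y : z)` be a rational point of `X_E⁻(7) = {𝓖 = 0}` with `d₂(P) ≠ 0` which is not a point of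
inflection (`H(𝓖)(P) ≠ 0`).  Then the member `E_P` of the family (4.8) for `(𝓖, d₂)` (assumed non-singular) is `7`-congruent
to `E`: there is an isomorphism of `Γ_ℚ`-modules `E_P[7] ≅ E[7]` (print: REVERSE `7`-congruent, i.e. inverting the Weil pairing;
that clause is dropped).  NAMED FACT, not proved here.
[cite: Fisher2014SevenElevenCongruent, Thm. 4.8 with Thm. 4.6, display (4.8), and Thm. 3.9 (pp. 546, 555)] -/
def thm48_sevenCongruent_twistQuartic7Rev : Prop :=
  ∀ (c₄ c₆ x y z : ℚ) [(c4c6Model c₄ c₆).IsElliptic] [(twistMember7Rev c₄ c₆ x y z).IsElliptic],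
    c₄ ≠ 0 → c₆ ≠ 0 →
    MvPolynomial.eval ![x, y, z] (twistQuartic7Rev c₄ c₆) = 0 →
    MvPolynomial.eval ![x, y, z] (twistCubic7Rev c₄ c₆) ≠ 0 →
    MvPolynomial.eval ![x, y, z] (kleinH (twistQuartic7Rev c₄ c₆)) ≠ 0 →
    ∃ e : geomTorsion (twistMember7Rev c₄ c₆ x y z) (7 : ℤ) ≃+ geomTorsion (c4c6Model c₄ c₆) (7 : ℤ),
      ∀ (σ : Field.absoluteGaloisGroup ℚ) (T : geomTorsion (twistMember7Rev c₄ c₆ x y z) (7 : ℤ)),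
        e (σ • T) = σ • e T

/-! ### Proved: transport to an arbitrary model -/

/-- **Transport of Theorem 4.8 (`Y_E(7)`) to any model.** For every elliptic curve `W/ℚ` with `c₄(W) ≠ 0`, `c₆(W) ≠ 0`
(`j ≠ 0, 1728`) and every rational point `P = (x : y : z)` of the twist `X_W(7) = {𝓕 = 0}` written for the `c₄,c₆`-model of
`W`, off `{d₁ = 0}` and off the Hessian, with non-singular member `E_P`: `E_P[7] ≅ W[7]` as `Γ_ℚ`-modules.  Conditional on the
named fact `thm48_sevenCongruent_twistQuartic7`; the transport along `W ≅ c4c6Model W.c₄ W.c₆` is proved.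
[cite: Fisher2014SevenElevenCongruent, Thm. 4.8] -/
theorem sevenCongruent_twistMember7 (hF : thm48_sevenCongruent_twistQuartic7)
    (W : WeierstrassCurve ℚ) [W.IsElliptic] (x y z : ℚ) [(twistMember7 W.c₄ W.c₆ x y z).IsElliptic]
    (h0 : W.c₄ ≠ 0) (h1728 : W.c₆ ≠ 0)
    (hP : MvPolynomial.eval ![x, y, z] (twistQuartic7 W.c₄ W.c₆) = 0)
    (hd : MvPolynomial.eval ![x, y, z] (twistCubic7 W.c₄ W.c₆) ≠ 0)
    (hH : MvPolynomial.eval ![x, y, z] (kleinH (twistQuartic7 W.c₄ W.c₆)) ≠ 0) :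
    ∃ e : geomTorsion (twistMember7 W.c₄ W.c₆ x y z) (7 : ℤ) ≃+ geomTorsion W (7 : ℤ),
      ∀ (σ : Field.absoluteGaloisGroup ℚ) (T : geomTorsion (twistMember7 W.c₄ W.c₆ x y z) (7 : ℤ)),
        e (σ • T) = σ • e T := by
  obtain ⟨e₁, he₁⟩ := hF W.c₄ W.c₆ x y z h0 h1728 hP hd hH
  obtain ⟨e₂, he₂⟩ := exists_geomTorsion_addEquiv_c4c6Model W 7
  refine ⟨e₁.trans e₂.symm, fun σ T => ?_⟩
  simp only [AddEquiv.trans_apply]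
  apply e₂.injective
  rw [AddEquiv.apply_symm_apply, he₂, AddEquiv.apply_symm_apply, he₁]

/-- **Transport of Theorem 4.8 (`Y_E⁻(7)`) to any model.** As `sevenCongruent_twistMember7`, for the reverse family
`(𝓖, d₂)`.  Conditional on the named fact `thm48_sevenCongruent_twistQuartic7Rev`; the transport is proved.
[cite: Fisher2014SevenElevenCongruent, Thm. 4.8] -/
theorem sevenCongruent_twistMember7Rev (hF : thm48_sevenCongruent_twistQuartic7Rev)
    (W : WeierstrassCurve ℚ) [W.IsElliptic] (x y z : ℚ) [(twistMember7Rev W.c₄ W.c₆ x y z).IsElliptic]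
    (h0 : W.c₄ ≠ 0) (h1728 : W.c₆ ≠ 0)
    (hP : MvPolynomial.eval ![x, y, z] (twistQuartic7Rev W.c₄ W.c₆) = 0)
    (hd : MvPolynomial.eval ![x, y, z] (twistCubic7Rev W.c₄ W.c₆) ≠ 0)
    (hH : MvPolynomial.eval ![x, y, z] (kleinH (twistQuartic7Rev W.c₄ W.c₆)) ≠ 0) :
    ∃ e : geomTorsion (twistMember7Rev W.c₄ W.c₆ x y z) (7 : ℤ) ≃+ geomTorsion W (7 : ℤ),
      ∀ (σ : Field.absoluteGaloisGroup ℚ) (T : geomTorsion (twistMember7Rev W.c₄ W.c₆ x y z) (7 : ℤ)),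
        e (σ • T) = σ • e T := by
  obtain ⟨e₁, he₁⟩ := hF W.c₄ W.c₆ x y z h0 h1728 hP hd hH
  obtain ⟨e₂, he₂⟩ := exists_geomTorsion_addEquiv_c4c6Model W 7
  refine ⟨e₁.trans e₂.symm, fun σ T => ?_⟩
  simp only [AddEquiv.trans_apply]
  apply e₂.injective
  rw [AddEquiv.apply_symm_apply, he₂, AddEquiv.apply_symm_apply, he₁]

end Literature.NumberTheory.EllipticCurves.Fisher2014

end
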